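import Summits.AtomisticToContinuum.BoseEinsteinCondensation.Theses.BECThomsonPrinciple
import Summits.AtomisticToContinuum.BoseEinsteinCondensation.Theses.BECPeriodicReduction
import Literature.MathematicalPhysics.QuantumManyBody.BoseGasCatStates

/-!
# Crux `PeriodicToDirichlet` (stmt-AtomisticToContinuum-9483) — typed signatures of the gen-1
strategy census (crux-strategist seat `cstrat-…-9483-s1`, 2026-08-17)

Companion of `Cruxes/PeriodicToDirichlet/STRATEGY-CENSUS.md` (gen 1). Every statement the census
discusses under `## Strengthen` / `## Decomposition` is typed here over tree vocabulary, and the cheap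
logical relations between them, the antecedent `A = PeriodicBEC` and the conjunct
`B = _root_.BoseEinsteinCondensation` are kernel-checked, so that the census's verdicts refer to
real objects:

* `GapWindowPeriodicBEC` (census S-g): torus BEC with a GAP-SCALE energy window `γ N / L²`;
  `periodicBEC_of_gapWindow` : it implies `A` (so it is a strengthening of the antecedent).
* `LocallyUniformPeriodicBEC` (census S-f′ / N-g): `A` with constants uniform on a density
  neighbourhood; `periodicBEC_of_locallyUniform` : it implies `A`.
* `interiorMode`, `InteriorCondensation` (census S-i): condensation of Dirichlet near-minimisers into
  the flat mode of a centred interior sub-cube of side `θ L` (a collar of width `(1-θ)L/2 ≫ ξ` is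
  discarded); `bec_of_interiorCondensation` : it implies `B` (mode freedom of `maxOccupation`), hence
  the crux (`crux_of_interiorCondensation`) — with `A` idle, which is the census's point.
* `SeamVanishing`, `SeamWalledBEC` (census D-e): the Dirichlet cube as the torus of side `L + R`
  cut along three seam slabs of width `R`; `crux_of_seam` records that the split
  `{SeamWalledBEC → B, A → SeamWalledBEC}` has the crux as its second piece.

Nothing here is a line or a stub; no statement is claimed provable beyond the four small theorems.
-/

noncomputable section

namespace Summit.AtomisticToContinuum.BoseEinsteinCondensation.Cruxes.PeriodicToDirichlet.CensusS1

open MeasureTheory Filter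
open scoped ENNReal NNReal
open Literature.MathematicalPhysics.QuantumManyBody.BoseGas
open Summit.AtomisticToContinuum.BoseEinsteinCondensation.Theses

/-! ## S-g — gap-window torus BEC -/

/-- Census S-g. Torus BEC certified in a GAP-SCALE window: every periodic state within `γ N / L_N²` of
`E₀^per` (not merely within an unknown `δ_N`) has `n₀ ≥ cN`. Consistent with `v = 0` (exact:
`N - n₀ ≤ (E - E₀) L²/4π²`) and with Bogoliubov theory (a window `γN/L²` buys `≈ γN/(8π²)` extra
depletion through lowest phonons). [folklore] -/
def GapWindowPeriodicBEC : Prop :=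
  ∀ v : ℝ → ℝ≥0∞, IsRepulsiveFiniteRange v → ∃ ρ₀ : ℝ, 0 < ρ₀ ∧ ∀ ρ : ℝ, 0 < ρ → ρ < ρ₀ →
    ∃ c γ : ℝ, 0 < c ∧ 0 < γ ∧ ∀ᶠ N : ℕ in atTop, ∀ Ψ : PeriodicTrialState N (sideLength ρ N),
      periodicEnergy v Ψ ≤ periodicGroundStateEnergy v N (sideLength ρ N) +
          ENNReal.ofReal (γ * N / sideLength ρ N ^ 2) →
        ENNReal.ofReal (c * N) ≤ condensateOccupation N (sideLength ρ N) Ψ.ψ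

theorem sideLength_pos {ρ : ℝ} (hρ : 0 < ρ) {N : ℕ} (hN : 0 < N) : 0 < sideLength ρ N := by
  unfold sideLength
  exact Real.rpow_pos_of_pos (div_pos (Nat.cast_pos.2 hN) hρ) _

/-- The gap-window form implies the antecedent `A = PeriodicBEC` (take `δ_N = γN/L_N² > 0`). [folklore] -/
theorem periodicBEC_of_gapWindow (h : GapWindowPeriodicBEC) : BECPeriodicReduction.PeriodicBEC := by
  intro v hv
  obtain ⟨ρ₀, hρ₀, H⟩ := h v hv
  refine ⟨ρ₀, hρ₀, fun ρ hρ hρlt => ?_⟩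
  obtain ⟨c, γ, hc, hγ, hev⟩ := H ρ hρ hρlt
  refine ⟨c, hc, ?_⟩
  filter_upwards [hev, eventually_gt_atTop 0] with N hN hNpos
  have hL : 0 < sideLength ρ N := sideLength_pos hρ hNpos
  have hNr : (0 : ℝ) < N := Nat.cast_pos.2 hNpos
  exact ⟨ENNReal.ofReal (γ * N / sideLength ρ N ^ 2), ENNReal.ofReal_pos.2 (by positivity), hN⟩

/-! ## S-f′ / N-g — locally uniform constants -/

/-- Census S-f′. `A` with its constant `c` and threshold `N₀` uniform for all densities `ρ'` in a
neighbourhood of `ρ` (what a matched-bulk-density transfer would have to consume; `A` itself asserts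
no uniformity in `ρ`, and Baire category supplies it only on an open dense set of densities). [folklore] -/
def LocallyUniformPeriodicBEC : Prop :=
  ∀ v : ℝ → ℝ≥0∞, IsRepulsiveFiniteRange v → ∃ ρ₀ : ℝ, 0 < ρ₀ ∧ ∀ ρ : ℝ, 0 < ρ → ρ < ρ₀ →
    ∃ η c : ℝ, 0 < η ∧ 0 < c ∧ ∃ N₀ : ℕ, ∀ ρ' : ℝ, 0 < ρ' → |ρ' - ρ| < η → ∀ N : ℕ, N₀ ≤ N →
      ∃ δ : ℝ≥0∞, 0 < δ ∧ ∀ Ψ : PeriodicTrialState N (sideLength ρ' N),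
        periodicEnergy v Ψ ≤ periodicGroundStateEnergy v N (sideLength ρ' N) + δ →
          ENNReal.ofReal (c * N) ≤ condensateOccupation N (sideLength ρ' N) Ψ.ψ

/-- The locally uniform form implies `A` (specialise `ρ' = ρ`). [folklore] -/
theorem periodicBEC_of_locallyUniform (h : LocallyUniformPeriodicBEC) :
    BECPeriodicReduction.PeriodicBEC := by
  intro v hv
  obtain ⟨ρ₀, hρ₀, H⟩ := h v hv
  refine ⟨ρ₀, hρ₀, fun ρ hρ hρlt => ?_⟩
  obtain ⟨η, c, hη, hc, N₀, hN₀⟩ := H ρ hρ hρlt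
  refine ⟨c, hc, ?_⟩
  filter_upwards [eventually_ge_atTop N₀] with N hN
  exact hN₀ ρ hρ (by simpa using hη) N hN

/-! ## S-i — collar-free (interior) condensation suffices for `B` -/

/-- Lower corner `((1-θ)L/2, (1-θ)L/2, (1-θ)L/2)` of the centred sub-cube of side `θL`. [folklore] -/
def interiorCorner (L θ : ℝ) : Space := WithLp.toLp 2 fun _ => (1 - θ) / 2 * L

/-- The normalised flat mode `(θL)^{-3/2} 1_Q` of the centred interior sub-cube
`Q = (1-θ)L/2 + [0, θL)³`. [folklore] -/
def interiorMode (L θ : ℝ) (x : Space) : ℂ := constantMode (θ * L) (x - interiorCorner L θ)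

theorem aestronglyMeasurable_interiorMode (L θ : ℝ) :
    AEStronglyMeasurable (interiorMode L θ) volume :=
  (aestronglyMeasurable_constantMode (θ * L)).comp_quasiMeasurePreserving
    (measurePreserving_sub_right volume (interiorCorner L θ)).quasiMeasurePreserving

theorem lintegral_interiorMode_sq {L θ : ℝ} (hL : 0 < L) (hθ : 0 < θ) :
    ∫⁻ x, (‖interiorMode L θ x‖₊ : ℝ≥0∞) ^ 2 = 1 := by
  unfold interiorMode
  rw [lintegral_sub_right_eq_self (fun x => (‖constantMode (θ * L) x‖₊ : ℝ≥0∞) ^ 2)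
    (interiorCorner L θ)]
  exact lintegral_constantMode_sq (by positivity)

/-- Census S-i. Interior (collar-free) condensation of Dirichlet near-minimisers: for some fixed
fraction `θ ∈ (0,1]` the flat mode of the centred sub-cube of side `θ L_N` carries `≥ cN` particles.
The discarded collar has width `(1-θ)L_N/2`, eventually `≫` any healing length. [folklore] -/
def InteriorCondensation : Prop :=
  ∀ v : ℝ → ℝ≥0∞, IsRepulsiveFiniteRange v → ∃ ρ₀ : ℝ, 0 < ρ₀ ∧ ∀ ρ : ℝ, 0 < ρ → ρ < ρ₀ →
    ∃ θ c : ℝ, 0 < θ ∧ θ ≤ 1 ∧ 0 < c ∧ ∀ᶠ N : ℕ in atTop, ∃ δ : ℝ≥0∞, 0 < δ ∧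
      ∀ Ψ : TrialState N (sideLength ρ N),
        energy v Ψ ≤ groundStateEnergy v N (sideLength ρ N) + δ →
          ENNReal.ofReal (c * N) ≤ occupation N (interiorMode (sideLength ρ N) θ) Ψ.ψ

/-- Interior condensation implies the conjunct `B` (mode freedom of `maxOccupation`,
`le_condensateNumber`). [folklore] -/
theorem bec_of_interiorCondensation (h : InteriorCondensation) : _root_.BoseEinsteinCondensation := by
  intro v hv
  obtain ⟨ρ₀, hρ₀, H⟩ := h v hv
  refine ⟨ρ₀, hρ₀, fun ρ hρ hρlt => ?_⟩
  obtain ⟨θ, c, hθ, _hθ1, hc, hev⟩ := H ρ hρ hρlt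
  refine ⟨c, hc, ?_⟩
  filter_upwards [hev, eventually_gt_atTop 0] with N hN hNpos
  obtain ⟨δ, hδ, hΨ⟩ := hN
  have hL : 0 < sideLength ρ N := sideLength_pos hρ hNpos
  exact le_condensateNumber v hδ fun Ψ hE => (hΨ Ψ hE).trans
    (occupation_le_maxOccupation Ψ.ψ (aestronglyMeasurable_interiorMode _ θ)
      (lintegral_interiorMode_sq hL hθ))

/-- Hence interior condensation closes the crux — WITHOUT touching the antecedent `A`
(census: every such line is a line on `B`, not on 9483). [folklore] -/
theorem crux_of_interiorCondensation (h : InteriorCondensation) :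
    BECThomsonPrinciple.PeriodicToDirichlet :=
  fun _ => bec_of_interiorCondensation h

/-! ## D-e — the seam-walled torus (same `N`, one Hilbert space) -/

/-- A periodic state on the torus of side `L'` VANISHES ON THE SEAM SLABS of width `R`: `Ψ(X) = 0`
whenever some coordinate of some particle is within `R/2` of the lattice `L'ℤ`. For `L' = L + R`
these are exactly (translates of) the Dirichlet trial states of the cube of side `L`, and with
`R ≥ range(v)` no pair interacts across a slab. [folklore] -/
def SeamVanishing {N : ℕ} {L' : ℝ} (R : ℝ) (Ψ : PeriodicTrialState N L') : Prop :=
  ∀ X : Config N, (∃ (i : Fin N) (k : Fin 3) (m : ℤ), |X i k - m * L'| ≤ R / 2) → Ψ.ψ X = 0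

/-- Census D-e, piece 2. BEC (flat mode of the fundamental cell) for near-minimisers of the periodic
energy AMONG SEAM-VANISHING STATES on the torus of side `sideLength ρ N + R`, `R` = a range of `v`.
This is the Dirichlet problem of `B` written on the torus where `A` lives (same `N`; density
`N/(L_N+R)³ → ρ`); the census records that `A → SeamWalledBEC` is the crux again. [folklore] -/
def SeamWalledBEC : Prop :=
  ∀ v : ℝ → ℝ≥0∞, IsRepulsiveFiniteRange v → ∀ R : ℝ, 0 < R → (∀ r, R < r → v r = 0) →
    ∃ ρ₀ : ℝ, 0 < ρ₀ ∧ ∀ ρ : ℝ, 0 < ρ → ρ < ρ₀ → ∃ c : ℝ, 0 < c ∧ ∀ᶠ N : ℕ in atTop,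
      ∃ δ : ℝ≥0∞, 0 < δ ∧ ∀ Ψ : PeriodicTrialState N (sideLength ρ N + R), SeamVanishing R Ψ →
        periodicEnergy v Ψ ≤ (⨅ (Φ : PeriodicTrialState N (sideLength ρ N + R))
            (_ : SeamVanishing R Φ), periodicEnergy v Φ) + δ →
          ENNReal.ofReal (c * N) ≤ maxOccupation N ((cellN N (sideLength ρ N + R)).indicator Ψ.ψ)

/-- Census D-e, piece 1 (the identification, size M–L, not proved here): seam-walled BEC gives `B`. -/
def SeamReduction : Prop := SeamWalledBEC → _root_.BoseEinsteinCondensation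

/-- The D-e split assembled: its second hypothesis `A → SeamWalledBEC` is the crux transported to the
torus, i.e. the whole difficulty (census verdict: not a split). [folklore] -/
theorem crux_of_seam (h₁ : SeamReduction)
    (h₂ : BECPeriodicReduction.PeriodicBEC → SeamWalledBEC) :
    BECThomsonPrinciple.PeriodicToDirichlet :=
  fun hA => h₁ (h₂ hA)

/-- Sanity: the crux's antecedent is literally `BECPeriodicReduction.PeriodicBEC`. -/
example : BECThomsonPrinciple.PeriodicToDirichlet =
    (BECPeriodicReduction.PeriodicBEC → _root_.BoseEinsteinCondensation) := rfl

end Summit.AtomisticToContinuum.BoseEinsteinCondensation.Cruxes.PeriodicToDirichlet.CensusS1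

end
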